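import Literature.Analysis.FunctionSpaces.TorusSpaceTimeL3Cauchy
import Literature.Analysis.FluidPDE.ClassicalNSFourierModes
import Literature.Analysis.FluidPDE.LongTimeAverageSlidingWindow
import HarnessLib

/-!
# Route EulerLimit (AnomalousDissipation) — slab tools for the reduction
# `stub_loudSpaceTightFamily → stub_loudTightFamily` (crux `EulerlimitThesisV2`, line `tight`)

Helper file (`--supports stmt-AnomalousDissipation-0511`) for the registered reduction stub
`stub_loudTightOfSpaceTight` of line `tight` (STUB-PLAN `stub_loudTightFamily`, top plan SHRINK):
four slab (`(0,τ) × 𝕋³`) tools, all folklore measure theory / a corollary of a proved tree theorem,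

* `loudTight_setLIntegral_Ioo_comp_add_of_periodic` (L0) — period windows of a `τ`-periodic
  `ℝ≥0∞`-valued integrand may be shifted: `∫⁻_{(0,τ)} g (t + s) = ∫⁻_{(0,τ)} g`;
* `loudTight_modeLipschitz` (L1) — same-force mode-Lipschitz bound for classical Navier–Stokes
  solutions on `ℝ × 𝕋³` with energy `≤ E` and `|ν| ≤ νmax`:
  `‖û(t,k) − û(s,k)‖ ≤ |t − s| · L_k(f, E, νmax)` (corollary of the proved
  `Torus.IsClassicalNSSolutionOn.norm_mFourierCoeff_sub_le`, Robinson–Rodrigo–Sadowski 2016,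
  Thm. 4.4 Step 3);
* `loudTight_slab_mollify_sub_self_le` (L2) — slab CET (6): the slab `L³` mollification error of a
  jointly smooth field is at most its slab `L³` translation modulus at the mollifier scale
  (Minkowski–Jensen `lintegral_rpow_enorm_integral_smul_le` on `((0,τ) × 𝕋³) × 𝕋³`;
  Constantin–E–Titi 1994, (6));
* `loudTight_slabMass_le` (L3) — the slab `L³` mass of a jointly smooth field is bounded in
  terms of its energy bound and ONE scale of its slab `L³` translation modulus
  (`w = ρ_δ ⋆ w + (w − ρ_δ ⋆ w)`, sup bound `Torus.norm_kernel_convolution_apply_le`, L2).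

The file ends with the registered tools stub `stub_loudTightSlabTools` (conjunction of the four
statements).  No new definitions, no named facts.
-/

noncomputable section

-- D-0017: single-problem summit ⇒ the duplicated namespace segment is by design.
set_option linter.dupNamespace false

open MeasureTheory Set Filter Function UnitAddTorus Topology
open scoped ENNReal NNReal Convolution Interval

namespace Summit.AnomalousDissipation.AnomalousDissipation.Theorems

open Literature.Analysis.FunctionSpaces Literature.Analysis.FunctionSpaces.Torus

/-- The physical flat unit torus `𝕋³` (local notation, as in the skeleton of line `tight`). -/
local notation "𝕋³" => UnitAddTorus (Fin 3)
/-- Velocity values (local notation, as in the skeleton of line `tight`). -/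
local notation "E³" => EuclideanSpace ℝ (Fin 3)

/-! ## L0 — shifting period windows -/

/-- **L0.** Period windows of a `τ`-periodic `ℝ≥0∞`-valued function may be shifted:
`∫⁻_{(0,τ)} g (t + s) dt = ∫⁻_{(0,τ)} g` for every real `s` (translation invariance of Lebesgue
measure and `AddCircle.lintegral_preimage`). [folklore] -/
theorem loudTight_setLIntegral_Ioo_comp_add_of_periodic {g : ℝ → ℝ≥0∞} {τ : ℝ} (hτ : 0 < τ)
    (hg : Periodic g τ) (s : ℝ) :
    ∫⁻ t in Ioo 0 τ, g (t + s) = ∫⁻ t in Ioo 0 τ, g t := by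
  rw [Literature.Analysis.FluidPDE.setLIntegral_Ioo_add_right g 0 τ s, zero_add]
  have h1 : ∫⁻ t in Ioo s (τ + s), g t = ∫⁻ t in Ioc s (s + τ), g t := by
    rw [add_comm τ s]
    exact setLIntegral_congr Ioo_ae_eq_Ioc
  have h2 : ∫⁻ t in Ioo 0 τ, g t = ∫⁻ t in Ioc 0 (0 + τ), g t := by
    rw [zero_add]
    exact setLIntegral_congr Ioo_ae_eq_Ioc
  rw [h1, h2]
  haveI : Fact (0 < τ) := ⟨hτ⟩
  have e1 := AddCircle.lintegral_preimage τ s hg.lift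
  have e2 := AddCircle.lintegral_preimage τ 0 hg.lift
  simp only [Periodic.lift_coe] at e1 e2
  rw [e1, e2]

/-! ## L1 — same-force mode-Lipschitz bound -/

/-- `∫ ‖v‖ ≤ (1 + ∫ ‖v‖²) / 2` for a continuous field on the probability space `𝕋³`
(`2a ≤ 1 + a²` pointwise; replaces Cauchy–Schwarz `∫‖v‖ ≤ (∫‖v‖²)^{1/2}`). [folklore] -/
theorem loudTight_integral_norm_le_half_one_add {v : 𝕋³ → E³} (hv : Continuous v) :
    ∫ x, ‖v x‖ ≤ (1 + ∫ x, ‖v x‖ ^ 2) / 2 := by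
  have hi2 : Integrable (fun x => ‖v x‖ ^ 2) volume := (hv.norm.pow 2).integrable_unitAddTorus
  have h1 : ∫ x, ‖v x‖ ≤ ∫ x, (1 + ‖v x‖ ^ 2) / 2 := by
    refine integral_mono hv.norm.integrable_unitAddTorus ?_ fun x => ?_
    · exact ((continuous_const.add (hv.norm.pow 2)).div_const _).integrable_unitAddTorus
    · nlinarith [sq_nonneg (‖v x‖ - 1)]
  have h2 : ∫ x, (1 + ‖v x‖ ^ 2) / 2 = (1 + ∫ x, ‖v x‖ ^ 2) / 2 := by
    rw [integral_div, integral_add (integrable_const _) hi2]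
    simp
  linarith [h1, h2.le, h2.ge]

/-- **L1 (same-force mode-Lipschitz bound).** For a steady force `f`, an energy level `E` and a
viscosity ceiling `νmax` there are constants `L_k ≥ 0` such that every classical solution
`(u, p)` of `NS(ν, f)` on `ℝ × 𝕋³` with `|ν| ≤ νmax` and `∫‖u(t)‖² ≤ E` for all `t` has
Lipschitz-in-time Fourier coefficients: `‖û(t,k) − û(s,k)‖ ≤ |t − s| · L_k`.  Corollary of the
proved tree theorem `Torus.IsClassicalNSSolutionOn.norm_mFourierCoeff_sub_le`
(`‖û(t,k) − û(s,k)‖ ≤ ∫ₛᵗ (C_k∫‖u‖² + |ν|4π²|k|²∫‖u‖ + ∫‖f‖)`), the integrand being bounded by a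
constant (`∫‖u‖ ≤ (1 + E)/2`).  Robinson–Rodrigo–Sadowski 2016, Thm. 4.4 Step 3 (4.12)–(4.13).
[cite: RobinsonRodrigoSadowski2016, Thm. 4.4 Step 3 (4.12)–(4.13)] -/
theorem loudTight_modeLipschitz (f : 𝕋³ → E³) (E νmax : ℝ) :
    ∃ L : (Fin 3 → ℤ) → ℝ, (∀ k, 0 ≤ L k) ∧
      ∀ (ν : ℝ) (u : ℝ → 𝕋³ → E³) (p : ℝ → 𝕋³ → ℝ),
        IsClassicalNSSolutionOn univ ν (fun _ => f) u p → |ν| ≤ νmax →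
        (∀ t, ∫ x, ‖u t x‖ ^ 2 ≤ E) →
        ∀ (k : Fin 3 → ℤ) (s t : ℝ),
          ‖mFourierCoeff (EuclideanSpace.complexify ∘ u t) k -
              mFourierCoeff (EuclideanSpace.complexify ∘ u s) k‖ ≤ |t - s| * L k := by
  set L : (Fin 3 → ℤ) → ℝ := fun k =>
    (Fintype.card (Fin 3) * (2 * Real.pi * Real.sqrt (freqNormSq k))) * |E| +
      |νmax| * (4 * Real.pi ^ 2 * freqNormSq k) * ((1 + |E|) / 2) + ∫ x, ‖f x‖ with hL
  have hL0 : ∀ k, 0 ≤ L k := fun k => by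
    have h1 : 0 ≤ freqNormSq k := freqNormSq_nonneg k
    have h3 : 0 ≤ ∫ x, ‖f x‖ := integral_nonneg fun _ => norm_nonneg _
    positivity
  refine ⟨L, hL0, fun ν u p h hν hE k => ?_⟩
  -- the case `s ≤ t`
  have key : ∀ s t : ℝ, s ≤ t → ‖mFourierCoeff (EuclideanSpace.complexify ∘ u t) k -
      mFourierCoeff (EuclideanSpace.complexify ∘ u s) k‖ ≤ |t - s| * L k := by
    intro s t hst
    have hE0 : 0 ≤ E := (integral_nonneg fun _ => by positivity).trans (hE 0)
    have hEabs : |E| = E := abs_of_nonneg hE0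
    have hν0 : |ν| ≤ |νmax| := hν.trans (le_abs_self _)
    set g : ℝ → ℝ := fun τ => (Fintype.card (Fin 3) * (2 * Real.pi * Real.sqrt (freqNormSq k))) *
      (∫ x, ‖u τ x‖ ^ 2) + |ν| * (4 * Real.pi ^ 2 * freqNormSq k) * (∫ x, ‖u τ x‖) +
      ∫ x, ‖f x‖ with hg
    have h1 : ‖mFourierCoeff (EuclideanSpace.complexify ∘ u t) k -
        mFourierCoeff (EuclideanSpace.complexify ∘ u s) k‖ ≤ ∫ τ in s..t, g τ :=
      h.norm_mFourierCoeff_sub_le convex_univ (mem_univ s) (mem_univ t) hst k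
    refine h1.trans ?_
    -- bound the integrand by the constant `L k`
    have hbound : ∀ τ ∈ Ι s t, ‖g τ‖ ≤ L k := by
      intro τ _
      have hu2 : 0 ≤ ∫ x, ‖u τ x‖ ^ 2 := integral_nonneg fun _ => by positivity
      have hu1 : 0 ≤ ∫ x, ‖u τ x‖ := integral_nonneg fun _ => norm_nonneg _
      have hf1 : 0 ≤ ∫ x, ‖f x‖ := integral_nonneg fun _ => norm_nonneg _
      have hk : 0 ≤ freqNormSq k := freqNormSq_nonneg k
      have hcont : Continuous (u τ) := (h.smooth_velocity.isSmooth_slice (mem_univ τ)).continuous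
      have hu1' : ∫ x, ‖u τ x‖ ≤ (1 + |E|) / 2 :=
        (loudTight_integral_norm_le_half_one_add hcont).trans (by rw [hEabs]; linarith [hE τ])
      have hu2' : ∫ x, ‖u τ x‖ ^ 2 ≤ |E| := (hE τ).trans (le_abs_self E)
      have hg0 : 0 ≤ g τ := by simp only [hg]; positivity
      rw [Real.norm_of_nonneg hg0]
      simp only [hg, hL]
      gcongr
    have h2 := intervalIntegral.norm_integral_le_of_norm_le_const hbound
    rw [Real.norm_eq_abs] at h2
    calc ∫ τ in s..t, g τ ≤ |∫ τ in s..t, g τ| := le_abs_self _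
      _ ≤ L k * |t - s| := h2
      _ = |t - s| * L k := mul_comm _ _
  intro s t
  rcases le_total s t with hst | hts
  · exact key s t hst
  · rw [norm_sub_rev, abs_sub_comm]
    exact key t s hts

/-! ## L2 — slab CET (6): the mollification error against the slab translation modulus -/

/-- A field that is jointly smooth on all of `ℝ × 𝕋³` is jointly continuous. [folklore] -/
theorem loudTight_continuous_uncurry {F : Type*} [NormedAddCommGroup F] [NormedSpace ℝ F]
    {w : ℝ → 𝕋³ → F} (hw : IsSmoothSpaceTimeOn univ w) : Continuous (uncurry w) := by
  refine continuous_uncurry_of_continuous_stLift ?_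
  have h := hw.continuousOn_stLift
  rwa [univ_prod_univ, continuousOn_univ] at h

/-- Slice-wise mollification `t ↦ ρ_ε ⋆ w(t)` of a field jointly smooth on all of `ℝ × 𝕋³` is
jointly smooth on all of `ℝ × 𝕋³` (`Torus.IsSmoothSpaceTimeOn.convolution`). [folklore] -/
theorem loudTight_isSmoothSpaceTimeOn_mollify {w : ℝ → 𝕋³ → E³}
    (hw : IsSmoothSpaceTimeOn univ w) {ε : ℝ} (hε : 0 < ε) (hε' : ε ≤ 1 / 4) :
    IsSmoothSpaceTimeOn univ (fun t => kernel ε ⋆ w t) :=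
  hw.convolution (continuous_kernel hε hε').integrable_unitAddTorus convex_univ
    (by rw [interior_univ]; exact univ_nonempty)

/-- **L2 (slab CET (6)).** For a field `w` jointly smooth on `ℝ × 𝕋³`, the standard mollifier
`ρ_ε = Torus.kernel ε` (`0 < ε ≤ 1/4`) and a window `(0, τ)`: if the slab `L³` translation
modulus at scale `ε` is at most `A`, i.e. `∫₀^τ∫‖w(t, x + h) − w(t, x)‖³ dx dt ≤ A` for all
`‖h‖ ≤ ε`, then so is the slab mollification error, `∫₀^τ∫‖(ρ_ε ⋆ w(t))(x) − w(t,x)‖³ dx dt ≤ A`.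
Proof: `(ρ_ε ⋆ w(t))(x) − w(t,x) = ∫ ρ_ε(y)(w(t, x − y) − w(t, x)) dy`
(`Torus.kernel_convolution_sub_self_apply`) and Minkowski–Jensen
(`lintegral_rpow_enorm_integral_smul_le`) on the product `((0,τ) × 𝕋³) × 𝕋³`, the kernel having
unit mass and support in `‖y‖ < ε` (Constantin–E–Titi 1994, (6), slab version; the slice version
is the tree's `Torus.eLpNorm_kernel_convolution_sub_self_le`). [cite: ConstantinETiti1994, (6)] -/
theorem loudTight_slab_mollify_sub_self_le {τ : ℝ} {w : ℝ → 𝕋³ → E³}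
    (hw : IsSmoothSpaceTimeOn univ w) {ε : ℝ} (hε : 0 < ε) (hε' : ε ≤ 1 / 4) {A : ℝ≥0∞}
    (hA : ∀ h : 𝕋³, ‖h‖ ≤ ε → ∫⁻ t in Ioo 0 τ, ∫⁻ x, ‖w t (x + h) - w t x‖ₑ ^ 3 ≤ A) :
    ∫⁻ t in Ioo 0 τ, ∫⁻ x, ‖(kernel ε ⋆ w t) x - w t x‖ₑ ^ 3 ≤ A := by
  set μT : Measure (ℝ × 𝕋³) := (volume.restrict (Ioo 0 τ)).prod volume with hμT
  have hwc : Continuous (uncurry w) := loudTight_continuous_uncurry hw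
  have hk : Continuous (kernel (d := Fin 3) ε) := continuous_kernel hε hε'
  -- the difference field `Φ z y = w z.1 (z.2 - y) - w z.1 z.2`
  set Φ : ℝ × 𝕋³ → 𝕋³ → E³ := fun z y => w z.1 (z.2 - y) - w z.1 z.2 with hΦ
  have hΦc : Continuous (uncurry Φ) := by
    have h1 : Continuous fun q : (ℝ × 𝕋³) × 𝕋³ => w q.1.1 (q.1.2 - q.2) :=
      hwc.comp ((continuous_fst.comp continuous_fst).prodMk
        ((continuous_snd.comp continuous_fst).sub continuous_snd))
    have h2 : Continuous fun q : (ℝ × 𝕋³) × 𝕋³ => w q.1.1 q.1.2 := hwc.comp continuous_fst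
    exact h1.sub h2
  have hΦm : AEStronglyMeasurable (uncurry Φ) (μT.prod volume) := hΦc.aestronglyMeasurable
  -- slab bound for each admissible `y`
  have hB : ∀ᵐ y ∂(volume : Measure 𝕋³), kernel ε y ≠ 0 →
      ∫⁻ z, ‖Φ z y‖ₑ ^ (3 : ℝ) ∂μT ≤ A := by
    refine ae_of_all _ fun y hy => ?_
    have hy' : ‖-y‖ ≤ ε := by
      rw [norm_neg]
      exact (mem_ball_zero_iff.1 (support_kernel_subset hε hy)).le
    have hmeas : AEMeasurable (fun z : ℝ × 𝕋³ => ‖Φ z y‖ₑ ^ (3 : ℝ)) μT :=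
      (hΦc.comp (continuous_id.prodMk continuous_const)).aestronglyMeasurable.enorm.pow_const _
    calc ∫⁻ z, ‖Φ z y‖ₑ ^ (3 : ℝ) ∂μT
        = ∫⁻ t in Ioo 0 τ, ∫⁻ x, ‖w t (x + -y) - w t x‖ₑ ^ 3 := by
          rw [hμT, lintegral_prod _ (by rwa [hμT] at hmeas)]
          simp only [hΦ, ENNReal.rpow_ofNat, sub_eq_add_neg]
      _ ≤ A := hA (-y) hy'
  -- Minkowski–Jensen on `((0,τ) × 𝕋³) × 𝕋³`
  have key := lintegral_rpow_enorm_integral_smul_le (μ := μT) hk.aestronglyMeasurable hΦm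
    (p := 3) (by norm_num) hB
  rw [lintegral_enorm_kernel hε hε', ENNReal.one_rpow, one_mul] at key
  -- the left-hand side as a product integral
  have hmol := loudTight_isSmoothSpaceTimeOn_mollify hw hε hε'
  have hPc : Continuous (uncurry fun t x => (kernel ε ⋆ w t) x - w t x) :=
    (loudTight_continuous_uncurry hmol).sub hwc
  have hpt : ∀ t x, (kernel ε ⋆ w t) x - w t x = ∫ y, kernel ε y • Φ (t, x) y := fun t x =>
    kernel_convolution_sub_self_apply ((hw.isSmooth_slice (mem_univ t)).integrable) hε hε' x
  calc ∫⁻ t in Ioo 0 τ, ∫⁻ x, ‖(kernel ε ⋆ w t) x - w t x‖ₑ ^ 3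
      = ∫⁻ z, ‖(kernel ε ⋆ w z.1) z.2 - w z.1 z.2‖ₑ ^ 3 ∂μT := by
        rw [hμT]
        exact (lintegral_prod (fun z : ℝ × 𝕋³ => ‖(kernel ε ⋆ w z.1) z.2 - w z.1 z.2‖ₑ ^ 3)
          (hPc.aestronglyMeasurable.enorm.pow_const _)).symm
    _ = ∫⁻ z, ‖∫ y, kernel ε y • Φ z y‖ₑ ^ (3 : ℝ) ∂μT := by
        refine lintegral_congr fun z => ?_
        rw [hpt z.1 z.2, ENNReal.rpow_ofNat]
    _ ≤ A := key

/-! ## L3 — the slab `L³` mass from the energy and one scale of the modulus -/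

/-- Sup bound for a mollified smooth slice through its `L¹` norm: with the constant
`C_δ = #freqBall 0 + ∑_{k ∉ freqBall 0} |ρ̂_δ(k)|` (depending on `δ` only),
`‖(ρ_δ ⋆ v)(x)‖ ≤ (∫‖v‖) · C_δ` (`Torus.norm_kernel_convolution_apply_le` with `K = 0`,
`‖v̂(k)‖ ≤ ∫‖v‖`). [folklore] -/
theorem loudTight_norm_mollify_le {δ : ℝ} (hδ : 0 < δ) (hδ' : δ ≤ 1 / 4) {v : 𝕋³ → E³}
    (hv : IsSmooth v) (x : 𝕋³) :
    ‖(kernel δ ⋆ v) x‖ ≤ (∫ y, ‖v y‖) * ((freqBall (d := Fin 3) 0).card +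
      ∑' k : {k // k ∉ freqBall (d := Fin 3) 0},
        ‖mFourierCoeff (fun y => (kernel δ y : ℂ)) (k : Fin 3 → ℤ)‖) := by
  have h := norm_kernel_convolution_apply_le hv hδ hδ' 0 x
  have h1 : ∑ k ∈ freqBall 0, ‖mFourierCoeff (EuclideanSpace.complexify ∘ v) k‖ ≤
      ∑ _k ∈ freqBall (d := Fin 3) 0, ∫ y, ‖v y‖ :=
    Finset.sum_le_sum fun k _ => norm_mFourierCoeff_complexify_le_integral_norm hv.integrable k
  rw [Finset.sum_const, nsmul_eq_mul] at h1
  calc _ ≤ _ := h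
    _ ≤ (freqBall (d := Fin 3) 0).card * (∫ y, ‖v y‖) + (∫ y, ‖v y‖) *
        ∑' k : {k // k ∉ freqBall (d := Fin 3) 0},
          ‖mFourierCoeff (fun y => (kernel δ y : ℂ)) (k : Fin 3 → ℤ)‖ := by gcongr
    _ = _ := by ring

/-- **L3 (the `L³`-mass clause is redundant).** For a window `(0,τ)`, an energy level `E` and a
scale `0 < δ ≤ 1/4` there is a bound `M` such that every field `w` jointly smooth on `ℝ × 𝕋³`
with `∫‖w(t)‖² ≤ E` for all `t` and slab `L³` translation modulus `≤ 1` at scale `δ`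
(`∫₀^τ∫‖w(t, x + h) − w(t, x)‖³ ≤ 1` for `‖h‖ ≤ δ`) has slab mass `∫₀^τ∫‖w‖³ ≤ M`.
Proof: `w = ρ_δ ⋆ w − (ρ_δ ⋆ w − w)`; the second term has slab `L³` norm `≤ 1` by L2, the
first is bounded pointwise by `(∫‖w(t)‖) C_δ ≤ ((1 + E)/2) C_δ` (`loudTight_norm_mollify_le`);
Minkowski in `L³((0,τ) × 𝕋³)` (`Torus.rpow_lintegral_sub_le`). [folklore] -/
theorem loudTight_slabMass_le (τ E : ℝ) {δ : ℝ} (hδ : 0 < δ) (hδ' : δ ≤ 1 / 4) :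
    ∃ M : ℝ, ∀ w : ℝ → 𝕋³ → E³, IsSmoothSpaceTimeOn univ w →
      (∀ t, ∫ x, ‖w t x‖ ^ 2 ≤ E) →
      (∀ h : 𝕋³, ‖h‖ ≤ δ → ∫⁻ t in Ioo 0 τ, ∫⁻ x, ‖w t (x + h) - w t x‖ₑ ^ 3 ≤ 1) →
      ∫⁻ t in Ioo 0 τ, ∫⁻ x, ‖w t x‖ₑ ^ 3 ≤ ENNReal.ofReal M := by
  -- the constants
  set Cδ : ℝ := (freqBall (d := Fin 3) 0).card +
    ∑' k : {k // k ∉ freqBall (d := Fin 3) 0},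
      ‖mFourierCoeff (fun y => (kernel δ y : ℂ)) (k : Fin 3 → ℤ)‖ with hCδ
  have hC0 : 0 ≤ Cδ := add_nonneg (Nat.cast_nonneg _) (tsum_nonneg fun _ => norm_nonneg _)
  set q : ℝ := (1 + |E|) / 2 * Cδ with hq
  set B : ℝ≥0∞ := ENNReal.ofReal q ^ 3 * ENNReal.ofReal τ with hB
  set M' : ℝ≥0∞ := (B ^ (1 / 3 : ℝ) + 1) ^ 3 with hM'
  have hBtop : B ≠ ⊤ := ENNReal.mul_ne_top (ENNReal.pow_ne_top ENNReal.ofReal_ne_top) ENNReal.ofReal_ne_top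
  have hM'top : M' ≠ ⊤ := ENNReal.pow_ne_top
    (ENNReal.add_ne_top.2 ⟨ENNReal.rpow_ne_top_of_nonneg (by norm_num) hBtop, ENNReal.one_ne_top⟩)
  refine ⟨M'.toReal, fun w hw hE hmod => ?_⟩
  rw [ENNReal.ofReal_toReal hM'top]
  set μT : Measure (ℝ × 𝕋³) := (volume.restrict (Ioo 0 τ)).prod volume with hμT
  have hE0 : 0 ≤ E := (integral_nonneg fun _ => by positivity).trans (hE 0)
  have hEabs : |E| = E := abs_of_nonneg hE0
  have hmol := loudTight_isSmoothSpaceTimeOn_mollify hw hδ hδ'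
  have hwc := loudTight_continuous_uncurry hw
  have hmc := loudTight_continuous_uncurry hmol
  -- measurability
  have hm1 : AEStronglyMeasurable (uncurry fun t x => (kernel δ ⋆ w t) x) μT :=
    hmc.aestronglyMeasurable
  have hm2 : AEStronglyMeasurable (uncurry fun t x => (kernel δ ⋆ w t) x - w t x) μT :=
    (hmc.sub hwc).aestronglyMeasurable
  -- (a) the mollification error has slab norm `≤ 1`
  have ha : ∫⁻ t in Ioo 0 τ, ∫⁻ x, ‖(kernel δ ⋆ w t) x - w t x‖ₑ ^ 3 ≤ 1 :=
    loudTight_slab_mollify_sub_self_le hw hδ hδ' hmod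
  -- (b) the mollified field is bounded pointwise by `q`
  have hb_pt : ∀ t x, ‖(kernel δ ⋆ w t) x‖ₑ ≤ ENNReal.ofReal q := by
    intro t x
    have hsl : IsSmooth (w t) := hw.isSmooth_slice (mem_univ t)
    have h1 := loudTight_norm_mollify_le hδ hδ' hsl x
    have h2 : ∫ y, ‖w t y‖ ≤ (1 + |E|) / 2 :=
      (loudTight_integral_norm_le_half_one_add hsl.continuous).trans
        (by rw [hEabs]; linarith [hE t])
    rw [← ofReal_norm]
    exact ENNReal.ofReal_le_ofReal (h1.trans (mul_le_mul_of_nonneg_right h2 hC0))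
  have hb : ∫⁻ t in Ioo 0 τ, ∫⁻ x, ‖(kernel δ ⋆ w t) x‖ₑ ^ 3 ≤ B := by
    calc ∫⁻ t in Ioo 0 τ, ∫⁻ x, ‖(kernel δ ⋆ w t) x‖ₑ ^ 3
        ≤ ∫⁻ t in Ioo 0 τ, ∫⁻ _x : 𝕋³, ENNReal.ofReal q ^ 3 :=
          lintegral_mono fun t => lintegral_mono fun x => by
            gcongr
            exact hb_pt t x
      _ = B := by
          rw [lintegral_lintegral_const_right, setLIntegral_const, Real.volume_Ioo, sub_zero]
  -- (c) Minkowski for `w = ρ_δ ⋆ w − (ρ_δ ⋆ w − w)`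
  have hMink := rpow_lintegral_sub_le (T := τ) hm1 hm2
  simp only [sub_sub_cancel] at hMink
  have hroot : (∫⁻ t in Ioo 0 τ, ∫⁻ x, ‖w t x‖ₑ ^ 3) ^ (1 / 3 : ℝ) ≤ B ^ (1 / 3 : ℝ) + 1 := by
    refine hMink.trans (add_le_add (rpow_third_le_rpow_third hb) ?_)
    simpa using rpow_third_le_rpow_third ha
  calc ∫⁻ t in Ioo 0 τ, ∫⁻ x, ‖w t x‖ₑ ^ 3
      = ((∫⁻ t in Ioo 0 τ, ∫⁻ x, ‖w t x‖ₑ ^ 3) ^ (1 / 3 : ℝ)) ^ 3 := by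
        rw [show (1 / 3 : ℝ) = ((3 : ℕ) : ℝ)⁻¹ by norm_num, ENNReal.rpow_inv_natCast_pow (by norm_num)]
    _ ≤ (B ^ (1 / 3 : ℝ) + 1) ^ 3 := by gcongr
    _ = M' := rfl

/-! ## The registered tools stub -/

/-- **Registered tools stub `stub_loudTightSlabTools`** of crux `EulerLimit.EulerlimitThesisV2`
(stmt-AnomalousDissipation-0511, line `tight`, STUB-PLAN `stub_loudTightFamily` item R3): the
conjunction L0 ∧ L1 ∧ L2 ∧ L3 of the slab tools of this file (period-window shift, same-force
mode-Lipschitz bound, slab CET (6), slab `L³` mass from energy + one scale of the modulus). [folklore] -/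
theorem stub_loudTightSlabTools :
    (∀ (g : ℝ → ENNReal) (τ s : ℝ), 0 < τ → Function.Periodic g τ → ∫⁻ t in Set.Ioo 0 τ, g (t + s) = ∫⁻ t in Set.Ioo 0 τ, g t) ∧ (∀ (f : 𝕋³ → E³) (E νmax : ℝ), ∃ L : (Fin 3 → ℤ) → ℝ, (∀ k, 0 ≤ L k) ∧ ∀ (ν : ℝ) (u : ℝ → 𝕋³ → E³) (p : ℝ → 𝕋³ → ℝ), Literature.Analysis.FunctionSpaces.Torus.IsClassicalNSSolutionOn Set.univ ν (fun _ => f) u p → |ν| ≤ νmax → (∀ t, ∫ x, ‖u t x‖ ^ 2 ≤ E) → ∀ (k : Fin 3 → ℤ) (s t : ℝ), ‖UnitAddTorus.mFourierCoeff (EuclideanSpace.complexify ∘ u t) k - UnitAddTorus.mFourierCoeff (EuclideanSpace.complexify ∘ u s) k‖ ≤ |t - s| * L k) ∧ (∀ (τ ε : ℝ) (w : ℝ → 𝕋³ → E³) (A : ENNReal), Literature.Analysis.FunctionSpaces.Torus.IsSmoothSpaceTimeOn Set.univ w → 0 < ε → ε ≤ 1 / 4 → (∀ h : 𝕋³, ‖h‖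 ≤ ε → ∫⁻ t in Set.Ioo 0 τ, ∫⁻ x, ‖w t (x + h) - w t x‖ₑ ^ 3 ≤ A) → ∫⁻ t in Set.Ioo 0 τ, ∫⁻ x, ‖MeasureTheory.convolution (Literature.Analysis.FunctionSpaces.Torus.kernel ε) (w t) (ContinuousLinearMap.lsmul ℝ ℝ) MeasureTheory.volume x - w t x‖ₑ ^ 3 ≤ A) ∧ (∀ (τ E δ : ℝ), 0 < δ → δ ≤ 1 / 4 → ∃ M : ℝ, ∀ w : ℝ → 𝕋³ → E³, Literature.Analysis.FunctionSpaces.Torus.IsSmoothSpaceTimeOn Set.univ w → (∀ t, ∫ x, ‖w t x‖ ^ 2 ≤ E) → (∀ h : 𝕋³, ‖h‖ ≤ δ → ∫⁻ t in Set.Ioo 0 τ, ∫⁻ x, ‖w t (x + h) - w t x‖ₑ ^ 3 ≤ 1) → ∫⁻ t in Set.Ioo 0 τ, ∫⁻ x, ‖w t x‖ₑ ^ 3 ≤ ENNReal.ofReal M) :=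
  ⟨fun _ _ s hτ hg => loudTight_setLIntegral_Ioo_comp_add_of_periodic hτ hg s,
    loudTight_modeLipschitz,
    fun _ _ _ _ hw hε hε' hA => loudTight_slab_mollify_sub_self_le hw hε hε' hA,
    fun τ E _ hδ hδ' => loudTight_slabMass_le τ E hδ hδ'⟩

end Summit.AnomalousDissipation.AnomalousDissipation.Theorems

end
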